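import Summits.ResolutionOfSingularities.ResolutionOfSingularities.Theorems.WeightedConstruction.Negative.WeightedConstructionFalseOfSurvivingFamily

/-!
# `WeightedConstruction` — negative lemma, chartwise form of the adversary's obligation

Crux `stmt-ResolutionOfSingularities-0571`
(`Summit.ResolutionOfSingularities.ResolutionOfSingularities.Theses.WeightedInvariant.WeightedConstruction`),
route `ResolutionOfSingularities/WeightedInvariant`; line lead c4, 2026-08-17. Companion of
`Negative/WeightedConstructionFalseOfSurvivingFamily.lean` (`SurvivingFamily → ¬ WeightedConstruction`,
`isEmpty_datum_of_survivingFamily`).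

`isEmpty_datum_of_chartwiseSurvivingFamily`: in the closure condition of a surviving family the adversary
may assume an explicit WEIGHTED CHART `(U ∋ y, u, w)` of the centre at the point (Włodarczyk,
arXiv:2203.03090, 2.1.10 / Lemma 2.1.12: `R|_U` is the Rees algebra of `(u₁^{1/w₁}, …, uₘ^{1/wₘ})`, the
`uᵢ` part of a regular system of parameters along `V(u)`, all vanishing at `y`) and need only defeat THAT
chart: find the successor on the explicit cobordant blow-up `B₊ = Spec Γ(V,U)[t⁻¹, uᵢ t^{wᵢ}] ∖ V(uᵢ t^{wᵢ})`
(Def. 2.3.5) with the `t⁻¹`-saturated transform of `X(U)` (3.3.12). So the adversary object of the crux's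
negative lemma is a statement about the explicit algebras `A[t⁻¹, u t^w]` only.
-/

noncomputable section

open CategoryTheory AlgebraicGeometry TopologicalSpace
open Literature.AlgebraicGeometry.Resolution
open Summit.ResolutionOfSingularities.ResolutionOfSingularities.Theses.WeightedInvariant

set_option linter.dupNamespace false

namespace Summit.ResolutionOfSingularities.ResolutionOfSingularities.Theorems.WeightedConstruction.Negative

variable {p : ℕ}

/-- **Chartwise surviving families suffice.** In the closure condition of a surviving family the
adversary may assume, besides everything in `SurvivingFamily`, an explicit WEIGHTED CHART of the centre
AT the point: an affine open `U ∋ y` of `V`, parameters `u₁, …, uₘ ∈ Γ(V, U)` and positive weights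
`w` with `R|_U` the Rees algebra of `(u₁^{1/w₁}, …, uₘ^{1/wₘ})` (`ReesAlgebraData.IsWeightedChart`: every
piece is the monomial ideal `(u^α : Σ wᵢαᵢ ≥ n)`, the `uᵢ` are part of a regular system of parameters
along `V(u)`), all `uᵢ` vanishing at `y`; and it suffices to defeat THAT chart, i.e. to find the
successor on the explicit cobordant blow-up `B₊ = Spec Γ(V,U)[t⁻¹, uᵢ t^{wᵢ}] ∖ V(uᵢ t^{wᵢ})`
(`affineCobordantBlowup.plus (weightedMonomialIdeal u w)`) with the `t⁻¹`-saturated transform of the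
ideal `X(U)` (`affineCobordantBlowup.strictTransformPlus`). Reason: a regular weighted centre has such a
chart around every point of its support (Włodarczyk 2.1.10), and on a chart the datum's objects
`R.cobordantPlus U`, `R.cobordantPlusι U`, `R.cobordantStrictTransform U` ARE these explicit ones.
[folklore] -/
theorem isEmpty_datum_of_chartwiseSurvivingFamily {k : Type} [Field k] [CharP k p] [PerfectField k]
    (G : ∀ ⦃Y : Scheme.{0}⦄, (Y ⟶ Spec (.of k)) → Y.IdealSheafData → Y → Prop)
    (hne : ∃ (Y : Scheme.{0}) (f : Y ⟶ Spec (.of k)) (_ : Smooth f) (_ : IsSeparated f)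
      (_ : QuasiCompact f) (X : Y.IdealSheafData) (y : Y), G f X y)
    (hsing : ∀ ⦃Y : Scheme.{0}⦄ (f : Y ⟶ Spec (.of k)) [Smooth f] [IsSeparated f] [QuasiCompact f]
      (X : Y.IdealSheafData) (y : Y), G f X y →
      ∃ x : X.subscheme, X.subschemeι x = y ∧ ¬ IsRegularLocalRing (X.subscheme.presheaf.stalk x))
    (hchart : ∀ ⦃Y : Scheme.{0}⦄ (f : Y ⟶ Spec (.of k)) [Smooth f] [IsSeparated f] [QuasiCompact f]
      (X : Y.IdealSheafData) (y : Y), G f X y →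
      ∀ (V : Y.Opens) (hyV : y ∈ V),
        (∀ (σ : Y ⟶ Y) [Smooth σ], σ ≫ f = f → X.comap σ = X → ∀ y' : Y, σ y' ∈ V ↔ y' ∈ V) →
        ∀ R : ReesAlgebraData (V : Scheme.{0}), R.IsRegularWeightedCentre →
          (⟨y, hyV⟩ : (V : Scheme.{0})) ∈ R.support →
          (∀ v ∈ R.support, ∃ x : (X.comap V.ι).subscheme, (X.comap V.ι).subschemeι x = v ∧
            ¬ IsRegularLocalRing ((X.comap V.ι).subscheme.presheaf.stalk x)) →
          (∀ (σ : (V : Scheme.{0}) ⟶ V) [Smooth σ] [Surjective σ], σ ≫ V.ι ≫ f = V.ι ≫ f →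
            (X.comap V.ι).comap σ = X.comap V.ι → ∀ n : ℕ, (R.piece n).comap σ = R.piece n) →
          ∀ (U : (V : Scheme.{0}).affineOpens), (⟨y, hyV⟩ : (V : Scheme.{0})) ∈ (U : (V : Scheme.{0}).Opens) →
          ∀ (m : ℕ) (u : Fin m → Γ((V : Scheme.{0}), U)) (w : Fin m → ℕ), R.IsWeightedChart U u w →
            (∀ i, (⟨y, hyV⟩ : (V : Scheme.{0})) ∉ (V : Scheme.{0}).basicOpen (u i)) →
            Smooth ((affineCobordantBlowup.plusπ (weightedMonomialIdeal u w) ≫ U.2.fromSpec) ≫ V.ι ≫ f) →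
            IsSeparated ((affineCobordantBlowup.plusπ (weightedMonomialIdeal u w) ≫ U.2.fromSpec) ≫ V.ι ≫ f) →
            QuasiCompact ((affineCobordantBlowup.plusπ (weightedMonomialIdeal u w) ≫ U.2.fromSpec) ≫ V.ι ≫ f) →
            ∃ (b : affineCobordantBlowup.plus (weightedMonomialIdeal u w))
              (W : Scheme.{0}) (h : W ⟶ Spec (.of k)) (_ : Smooth h) (_ : IsSeparated h)
              (_ : QuasiCompact h)
              (g₁ : W ⟶ affineCobordantBlowup.plus (weightedMonomialIdeal u w)) (_ : Smooth g₁)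
              (_ : g₁ ≫ (affineCobordantBlowup.plusπ (weightedMonomialIdeal u w) ≫ U.2.fromSpec) ≫
                V.ι ≫ f = h)
              (Y' : Scheme.{0}) (f' : Y' ⟶ Spec (.of k)) (_ : Smooth f') (_ : IsSeparated f')
              (_ : QuasiCompact f') (X' : Y'.IdealSheafData) (y' : Y')
              (g₂ : W ⟶ Y') (_ : Smooth g₂) (_ : g₂ ≫ f' = h) (w' : W),
              G f' X' y' ∧ g₁ w' = b ∧ g₂ w' = y' ∧
                (affineCobordantBlowup.strictTransformPlus (weightedMonomialIdeal u w)
                  ((X.comap V.ι).ideal U)).comap g₁ = X'.comap g₂) :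
    IsEmpty (WeightedResolutionDatum p) := by
  refine isEmpty_datum_of_survivingFamily G hne hsing ?_
  intro Y f _ _ _ X y hG V hyV hVsym R hreg hyR hsuppR hRsym hregime
  -- a weighted chart of the centre around `y`
  obtain ⟨U, hyU, m, u, w, hch⟩ := hreg ⟨y, hyV⟩
  have hfun : R.chartIdeals U = weightedMonomialIdeal u w := funext fun n => hch.ideal_eq n
  have hy0 : ∀ i, (⟨y, hyV⟩ : (V : Scheme.{0})) ∉ (V : Scheme.{0}).basicOpen (u i) :=
    (ReesAlgebraData.IsWeightedChart.mem_support_iff R hch hyU).mp hyR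
  have hreg' := hregime U
  refine ⟨U, ?_⟩
  unfold ReesAlgebraData.cobordantPlusι at hreg'
  unfold ReesAlgebraData.cobordantPlus at hreg'
  unfold ReesAlgebraData.cobordantPlusι ReesAlgebraData.cobordantStrictTransform
  unfold ReesAlgebraData.cobordantPlus
  rw [hfun] at hreg' ⊢
  obtain ⟨b, W, h, j₁, j₂, j₃, g₁, l₁, hg₁, Y', f', i₁', i₂', i₃', X', y', g₂, l₂, hg₂, w', hG', hw₁,
      hw₂, hX⟩ :=
    hchart f X y hG V hyV hVsym R hreg hyR hsuppR hRsym U hyU m u w hch hy0 hreg'.1 hreg'.2.1 hreg'.2.2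
  exact ⟨b, W, h, j₁, j₂, j₃, g₁, l₁, hg₁, Y', f', i₁', i₂', i₃', X', y', g₂, l₂, hg₂, w', hG', hw₁,
    hw₂, hX⟩

end Summit.ResolutionOfSingularities.ResolutionOfSingularities.Theorems.WeightedConstruction.Negative

end
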